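import Summits.RiemannHypothesis.RiemannHypothesis.Theorems.WeilFormatCColumnEvenEntries
import Summits.RiemannHypothesis.RiemannHypothesis.Theorems.WeilFormatCColumnOdd
import HarnessLib

/-!
# Format C, L-C3b order 1 (even sector): the far COLUMNS of the even kernel are `(−1)^{i+m} g_m/(4m) + O(κ(i)/m²)`

Route context: Fourier–Galerkin / Schur-complement certificates of Weil positivity on a window ("format C";
cell memo `run/shared/lean/pub/rh-explicit/rh-explicit-weil-10/FORMATC-DESIGN.md` §4.2 / §9.5; supporting
stmt-RiemannHypothesis-0098; seat rh-explicit-weil-10).  Hypothesis `hU` of `WeilFormatC.sum_range_mul_mul_nonneg_of_certificate`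
needs the coupling columns `b_m(i) = M⁺(i,m)` (block row `i < B`, far column `m`) beyond the exactly enclosed range; at
first order they are ONE structured direction plus an `O(1/m²)` remainder.  For `G = Yoshida1992.gramCoeff a`, `0 < a`,
`0 ≤ i`, `1 ≤ m`, `2i ≤ m`, with `M⁺(i,m) = [i=0: G(0,m) | (G(i,m)+G(i,−m))/2]` (weil-2 SectorSplit, M-units),
`ω = π·/a`, `ΛΣ = Σ_{k∈weilPrimeIndex a} Λ(k)k^{−1/2}`, `E = weilArchDensity(2a)`, `s² = (e^{a/2} − e^{−a/2})²`:

* piece remainders from the uniform closed forms of `WeilFormatCColumnEvenEntries.lean`: `abs_evenPolar_col_le`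
  (`≤ (s²a/π²)/m²`), `abs_evenPrime_col_sub_le` (`≤ (2iΛΣ/π)/m²` off `(−1)^{i+m}Σ_k(Λ_k/√k)sin ω_mℓ_k/(πm)`),
  `abs_evenArch_col_sub_le` (`≤ (i/2 + 8a(1+E)/(3π²))/m²` off `(−1)^{i+m}/(4m)`);
* `abs_evenKernel_col_sub_le` — **`|M⁺(i,m) − (−1)^{i+m} g_m/(4m)| ≤ κ⁺(i)/m²`**, `g_m = 1 + (4/π)Σ_k(Λ_k/√k) sin(ω_m log k)`,
  `κ⁺(i) = s²a/π² + 2iΛΣ/π + i/2 + 8a(1+E)/(3π²)`.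

With `WeilFormatC.tailMajorant` (one direction `v(i) = (−1)^i`, weight `1/d̂_m`) this yields the explicit tail majorant `U₂`
of FORMATC-DESIGN §9.5 (sequel `WeilFormatCTailOrder1.lean`).  Elementary; standard axioms; no definitions; no RH claim.
-/

set_option autoImplicit false
-- `Summit.RiemannHypothesis.RiemannHypothesis.…` is the layout-mandated namespace (summit = problem name).
set_option linter.dupNamespace false

noncomputable section

open Complex Finset
open scoped Real BigOperators ArithmeticFunction.vonMangoldt

namespace Summit.RiemannHypothesis.RiemannHypothesis.Theorems.WeilFormatC

open Literature.NumberTheory.LFunctions Literature.NumberTheory.LFunctions.Yoshida1992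
open Literature.Analysis.SpecialFunctions

variable {a : ℝ}

/-! ## The order-1 remainder, piece by piece -/

section Remainder

-- `col_index_bounds'` and `abs_neg_one_zpow_natCast_add'` are in `WeilFormatCColumnOdd.lean`.

/-- **Polar column remainder**: `|M⁺_POL(i,m)| ≤ (s²a/π²)/m²` (`0 < a`, `1 ≤ m`, `i ≠ m`). -/
theorem abs_evenPolar_col_le (ha : 0 < a) {i m : ℕ} (hm : 1 ≤ m) (him : i ≠ m) :
    |(if i = 0 then polarCoeff a 0 m else if m = 0 then polarCoeff a i 0
      else (polarCoeff a i m + polarCoeff a i (-(m : ℤ))) / 2)|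
      ≤ ((Real.exp (a / 2) - Real.exp (-(a / 2))) ^ 2 * a / π ^ 2) / (m : ℝ) ^ 2 := by
  rw [evenPolar_col_eq a hm him]
  have hm0 : (0 : ℝ) < m := by exact_mod_cast hm
  have hci : 1 / (1 + 4 * freq a i ^ 2) ≤ 1 := by
    rw [div_le_one (by positivity)]; nlinarith [sq_nonneg (freq a i)]
  have hcm : 1 / (1 + 4 * freq a m ^ 2) ≤ a ^ 2 / (4 * π ^ 2 * m ^ 2) := by
    rw [freq_natCast, div_le_div_iff₀ (by positivity) (by positivity)]
    have : 4 * π ^ 2 * (m : ℝ) ^ 2 = a ^ 2 * (4 * (π * m / a) ^ 2) := by field_simp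
    nlinarith [this]
  rw [abs_mul, abs_mul, abs_mul, abs_neg_one_zpow_natCast_add', mul_one,
    abs_of_nonneg (by positivity : (0 : ℝ) ≤ 4 / a * (Real.exp (a / 2) - Real.exp (-(a / 2))) ^ 2),
    abs_of_nonneg (by positivity : (0 : ℝ) ≤ 1 / (1 + 4 * freq a i ^ 2)),
    abs_of_nonneg (by positivity : (0 : ℝ) ≤ 1 / (1 + 4 * freq a m ^ 2))]
  calc 4 / a * (Real.exp (a / 2) - Real.exp (-(a / 2))) ^ 2 * (1 / (1 + 4 * freq a i ^ 2))
        * (1 / (1 + 4 * freq a m ^ 2))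
      ≤ 4 / a * (Real.exp (a / 2) - Real.exp (-(a / 2))) ^ 2 * 1 * (a ^ 2 / (4 * π ^ 2 * m ^ 2)) := by
        gcongr
    _ = ((Real.exp (a / 2) - Real.exp (-(a / 2))) ^ 2 * a / π ^ 2) / (m : ℝ) ^ 2 := by
        field_simp

/-- **Prime column remainder**: `|M⁺_PRI(i,m) − (−1)^{i+m}(Σ_k (Λ_k/√k) sin ω_mℓ_k)/(πm)| ≤ (2iΛΣ/π)/m²`
(`1 ≤ m`, `2i ≤ m`). -/
theorem abs_evenPrime_col_sub_le (a : ℝ) {i m : ℕ} (hm : 1 ≤ m) (him : 2 * i ≤ m) :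
    |(if i = 0 then primeCoeff a 0 m else if m = 0 then primeCoeff a i 0
        else (primeCoeff a i m + primeCoeff a i (-(m : ℤ))) / 2)
      - (-1 : ℝ) ^ ((i : ℤ) + m) *
        (∑ k ∈ weilPrimeIndex a, (Λ k : ℝ) / Real.sqrt k * Real.sin (freq a m * Real.log k)) / (π * m)|
      ≤ (2 * i * (∑ k ∈ weilPrimeIndex a, (Λ k : ℝ) / Real.sqrt k) / π) / (m : ℝ) ^ 2 := by
  have him' : i < m := by omega
  have hm0 : (0 : ℝ) < m := by exact_mod_cast hm
  have hi0 : (0 : ℝ) ≤ i := by positivity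
  obtain ⟨hD34, hihalf, hDpos⟩ := col_index_bounds' hm him
  rw [evenPrime_col_eq a hm him']
  -- combine into one sum of differences
  have e : (-1 : ℝ) ^ ((i : ℤ) + m) * ∑ k ∈ weilPrimeIndex a, (Λ k : ℝ) / Real.sqrt k *
          (((m : ℝ) * Real.sin (freq a m * Real.log k) - i * Real.sin (freq a i * Real.log k))
            / (π * ((m : ℝ) ^ 2 - i ^ 2)))
        - (-1 : ℝ) ^ ((i : ℤ) + m) *
          (∑ k ∈ weilPrimeIndex a, (Λ k : ℝ) / Real.sqrt k * Real.sin (freq a m * Real.log k)) / (π * m)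
      = (-1 : ℝ) ^ ((i : ℤ) + m) * ∑ k ∈ weilPrimeIndex a, (Λ k : ℝ) / Real.sqrt k *
          ((((m : ℝ) * Real.sin (freq a m * Real.log k) - i * Real.sin (freq a i * Real.log k))
            / (π * ((m : ℝ) ^ 2 - i ^ 2))) - Real.sin (freq a m * Real.log k) / (π * m)) := by
    rw [mul_div_assoc, Finset.sum_div, ← mul_sub, ← Finset.sum_sub_distrib]
    congr 1
    exact Finset.sum_congr rfl fun k _ ↦ by ring
  rw [e, abs_mul, abs_neg_one_zpow_natCast_add', one_mul]
  have hK : ∀ k ∈ weilPrimeIndex a,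
      |(Λ k : ℝ) / Real.sqrt k *
        ((((m : ℝ) * Real.sin (freq a m * Real.log k) - i * Real.sin (freq a i * Real.log k))
          / (π * ((m : ℝ) ^ 2 - i ^ 2))) - Real.sin (freq a m * Real.log k) / (π * m))|
        ≤ (Λ k : ℝ) / Real.sqrt k * (2 * i / (π * m ^ 2)) := by
    intro k _
    have hw : 0 ≤ (Λ k : ℝ) / Real.sqrt k := div_nonneg ArithmeticFunction.vonMangoldt_nonneg (Real.sqrt_nonneg _)
    rw [abs_mul, abs_of_nonneg hw]
    refine mul_le_mul_of_nonneg_left ?_ hw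
    have hsm := Real.abs_sin_le_one (freq a m * Real.log k)
    have hsi := Real.abs_sin_le_one (freq a i * Real.log k)
    generalize Real.sin (freq a m * Real.log k) = sm at hsm ⊢
    generalize Real.sin (freq a i * Real.log k) = si at hsi ⊢
    have e : ((m : ℝ) * sm - i * si) / (π * ((m : ℝ) ^ 2 - i ^ 2)) - sm / (π * m)
        = ((i : ℝ) ^ 2 * sm - i * m * si) / (π * m * ((m : ℝ) ^ 2 - i ^ 2)) := by
      field_simp
      ring
    rw [e, abs_div, abs_of_pos (by positivity : (0 : ℝ) < π * m * ((m : ℝ) ^ 2 - i ^ 2)),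
      div_le_div_iff₀ (by positivity) (by positivity)]
    have hnum : |(i : ℝ) ^ 2 * sm - i * m * si| ≤ (i : ℝ) ^ 2 + i * m := by
      have h1 : |(i : ℝ) ^ 2 * sm| ≤ (i : ℝ) ^ 2 := by
        rw [abs_mul, abs_of_nonneg (by positivity : (0 : ℝ) ≤ (i : ℝ) ^ 2)]
        exact mul_le_of_le_one_right (by positivity) hsm
      have h2 : |(i : ℝ) * m * si| ≤ (i : ℝ) * m := by
        rw [abs_mul, abs_of_nonneg (by positivity : (0 : ℝ) ≤ (i : ℝ) * m)]
        exact mul_le_of_le_one_right (by positivity) hsi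
      exact (abs_sub _ _).trans (add_le_add h1 h2)
    have hlhs := mul_le_mul_of_nonneg_right hnum (by positivity : (0 : ℝ) ≤ π * m ^ 2)
    refine hlhs.trans ?_
    -- (i² + i m) π m² ≤ 2i · π m (m² − i²): the difference is π i m (m + i)(m − 2i) ≥ 0
    have h2i : (0 : ℝ) ≤ m - 2 * i := by
      have : 2 * (i : ℝ) ≤ m := by exact_mod_cast him
      linarith
    have key : 0 ≤ π * i * m * ((m : ℝ) + i) * (m - 2 * i) := by positivity
    nlinarith [key]
  refine (Finset.abs_sum_le_sum_abs _ _).trans ((Finset.sum_le_sum hK).trans (le_of_eq ?_))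
  rw [← Finset.sum_mul]
  field_simp

/-- **Archimedean column remainder**: `|M⁺_ARCH(i,m) − (−1)^{i+m}/(4m)| ≤ (i/2 + 8a(1+E)/(3π²))/m²`
(`0 < a`, `1 ≤ m`, `2i ≤ m`). -/
theorem abs_evenArch_col_sub_le (ha : 0 < a) {i m : ℕ} (hm : 1 ≤ m) (him : 2 * i ≤ m) :
    |(if i = 0 then archCoeff a 0 m else if m = 0 then archCoeff a i 0
        else (archCoeff a i m + archCoeff a i (-(m : ℤ))) / 2)
      - (-1 : ℝ) ^ ((i : ℤ) + m) / (4 * m)|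
      ≤ ((i : ℝ) / 2 + 8 * a * (1 + weilArchDensity (2 * a)) / (3 * π ^ 2)) / (m : ℝ) ^ 2 := by
  have him' : i < m := by omega
  have hm0 : (0 : ℝ) < m := by exact_mod_cast hm
  have hi0 : (0 : ℝ) ≤ i := by positivity
  obtain ⟨hD34, hihalf, hDpos⟩ := col_index_bounds' hm him
  rw [evenArch_col_eq a hm him']
  -- analytic inputs
  have hE0 : 0 < weilArchDensity (2 * a) := weilArchDensity_pos (by positivity)
  have hmr : |(m : ℝ) * ((Complex.digamma (1 / 4 + ((freq a m : ℝ) : ℂ) / 2 * I)).im - π / 2)| ≤ 2 * a / π := by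
    rw [abs_mul, abs_of_pos hm0]
    refine (mul_le_mul_of_nonneg_left (abs_im_digamma_freq_sub_le ha hm) hm0.le).trans (le_of_eq ?_)
    field_simp
  have hYi : |(i : ℝ) * (Complex.digamma (1 / 4 + ((freq a i : ℝ) : ℂ) / 2 * I)).im| ≤ i * (π / 2) + 2 * a / π := by
    by_cases hi : i = 0
    · subst hi; simp; positivity
    · have hi1 : 1 ≤ i := by omega
      have hi0' : (0 : ℝ) < i := by exact_mod_cast hi1
      have h := abs_im_digamma_freq_sub_le ha hi1
      have h' : |(Complex.digamma (1 / 4 + ((freq a i : ℝ) : ℂ) / 2 * I)).im| ≤ π / 2 + 2 * a / (π * i) := by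
        have := abs_sub_abs_le_abs_sub (Complex.digamma (1 / 4 + ((freq a i : ℝ) : ℂ) / 2 * I)).im (π / 2)
        rw [abs_of_pos (by positivity : (0 : ℝ) < π / 2)] at this
        linarith
      rw [abs_mul, abs_of_pos hi0']
      refine (mul_le_mul_of_nonneg_left h' hi0'.le).trans (le_of_eq ?_)
      field_simp
  have hTnum : |(m : ℝ) * archExpSumSin a m - i * archExpSumSin a i| ≤ weilArchDensity (2 * a) * a / π := by
    have h1 : 0 ≤ (m : ℝ) * archExpSumSin a m := mul_nonneg hm0.le (archExpSumSin_nonneg ha hm)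
    have h2 : (m : ℝ) * archExpSumSin a m ≤ weilArchDensity (2 * a) * a / π := by
      refine (mul_le_mul_of_nonneg_left (archExpSumSin_le ha hm) hm0.le).trans (le_of_eq ?_)
      field_simp
    have h3 : 0 ≤ (i : ℝ) * archExpSumSin a i ∧ (i : ℝ) * archExpSumSin a i ≤ weilArchDensity (2 * a) * a / π := by
      by_cases hi : i = 0
      · subst hi; simp; positivity
      · have hi1 : 1 ≤ i := by omega
        have hi0' : (0 : ℝ) < i := by exact_mod_cast hi1
        refine ⟨mul_nonneg hi0'.le (archExpSumSin_nonneg ha hi1), ?_⟩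
        refine (mul_le_mul_of_nonneg_left (archExpSumSin_le ha hi1) hi0'.le).trans (le_of_eq ?_)
        field_simp
    rw [abs_le]; constructor <;> linarith [h3.1, h3.2]
  generalize (Complex.digamma (1 / 4 + ((freq a m : ℝ) : ℂ) / 2 * I)).im = Ym at hmr ⊢
  generalize (Complex.digamma (1 / 4 + ((freq a i : ℝ) : ℂ) / 2 * I)).im = Yi at hYi ⊢
  generalize archExpSumSin a m = Tm at hTnum ⊢
  generalize archExpSumSin a i = Ti at hTnum ⊢
  generalize weilArchDensity (2 * a) = E at hE0 hTnum ⊢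
  -- rewrite: subtract the main part
  have e : (-1 : ℝ) ^ ((i : ℤ) + m) *
        (((m : ℝ) * Ym - i * Yi) / (2 * π * ((m : ℝ) ^ 2 - i ^ 2)) - ((m : ℝ) * Tm - i * Ti) / (π * ((m : ℝ) ^ 2 - i ^ 2)))
        - (-1 : ℝ) ^ ((i : ℤ) + m) / (4 * m)
      = (-1 : ℝ) ^ ((i : ℤ) + m) *
        (((m : ℝ) * (Ym - π / 2)) / (2 * π * ((m : ℝ) ^ 2 - i ^ 2))
          + (i : ℝ) ^ 2 / (4 * m * ((m : ℝ) ^ 2 - i ^ 2))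
          - (i : ℝ) * Yi / (2 * π * ((m : ℝ) ^ 2 - i ^ 2))
          - ((m : ℝ) * Tm - i * Ti) / (π * ((m : ℝ) ^ 2 - i ^ 2))) := by
    field_simp
    ring
  rw [e, abs_mul, abs_neg_one_zpow_natCast_add', one_mul]
  generalize (m : ℝ) ^ 2 - (i : ℝ) ^ 2 = D at hD34 hDpos ⊢
  -- termwise bounds with the common denominator shape
  have b1 : |((m : ℝ) * (Ym - π / 2)) / (2 * π * D)| ≤ (2 * a / π) / (2 * π * D) := by
    rw [abs_div, abs_of_pos (by positivity : (0 : ℝ) < 2 * π * D)]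
    exact div_le_div_of_nonneg_right hmr (by positivity)
  have b2 : |(i : ℝ) ^ 2 / (4 * m * D)| ≤ ((i : ℝ) * m / 2) / (4 * m * D) := by
    rw [abs_of_nonneg (by positivity)]
    exact div_le_div_of_nonneg_right (by nlinarith) (by positivity)
  have b3 : |(i : ℝ) * Yi / (2 * π * D)| ≤ (i * (π / 2) + 2 * a / π) / (2 * π * D) := by
    rw [abs_div, abs_of_pos (by positivity : (0 : ℝ) < 2 * π * D)]
    exact div_le_div_of_nonneg_right hYi (by positivity)
  have b4 : |((m : ℝ) * Tm - i * Ti) / (π * D)| ≤ (E * a / π) / (π * D) := by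
    rw [abs_div, abs_of_pos (by positivity : (0 : ℝ) < π * D)]
    exact div_le_div_of_nonneg_right hTnum (by positivity)
  have tri : |((m : ℝ) * (Ym - π / 2)) / (2 * π * D) + (i : ℝ) ^ 2 / (4 * m * D)
        - (i : ℝ) * Yi / (2 * π * D) - ((m : ℝ) * Tm - i * Ti) / (π * D)|
      ≤ (2 * a / π) / (2 * π * D) + ((i : ℝ) * m / 2) / (4 * m * D)
        + (i * (π / 2) + 2 * a / π) / (2 * π * D) + (E * a / π) / (π * D) := by
    have t1 := abs_add_le (((m : ℝ) * (Ym - π / 2)) / (2 * π * D)) ((i : ℝ) ^ 2 / (4 * m * D))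
    have t2 := abs_sub (((m : ℝ) * (Ym - π / 2)) / (2 * π * D) + (i : ℝ) ^ 2 / (4 * m * D))
      ((i : ℝ) * Yi / (2 * π * D))
    have t3 := abs_sub (((m : ℝ) * (Ym - π / 2)) / (2 * π * D) + (i : ℝ) ^ 2 / (4 * m * D)
      - (i : ℝ) * Yi / (2 * π * D)) (((m : ℝ) * Tm - i * Ti) / (π * D))
    linarith
  refine tri.trans ?_
  -- the sum equals (a(2+E)/π² + 3i/8)/D ≤ (4/(3m²))·(…) ≤ target
  have esum : (2 * a / π) / (2 * π * D) + ((i : ℝ) * m / 2) / (4 * m * D)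
      + (i * (π / 2) + 2 * a / π) / (2 * π * D) + (E * a / π) / (π * D)
      = (a * (2 + E) / π ^ 2 + 3 * i / 8) / D := by
    field_simp
    ring
  rw [esum]
  have hnum0 : 0 ≤ a * (2 + E) / π ^ 2 + 3 * i / 8 := by positivity
  calc (a * (2 + E) / π ^ 2 + 3 * i / 8) / D
      ≤ (a * (2 + E) / π ^ 2 + 3 * i / 8) / (3 / 4 * (m : ℝ) ^ 2) :=
        div_le_div_of_nonneg_left hnum0 (by positivity) hD34
    _ = (4 * a * (2 + E) / (3 * π ^ 2) + i / 2) / (m : ℝ) ^ 2 := by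
        field_simp
        ring
    _ ≤ ((i : ℝ) / 2 + 8 * a * (1 + E) / (3 * π ^ 2)) / (m : ℝ) ^ 2 := by
        refine div_le_div_of_nonneg_right ?_ (by positivity)
        have : 4 * a * (2 + E) ≤ 8 * a * (1 + E) := by nlinarith
        have := div_le_div_of_nonneg_right this (by positivity : (0 : ℝ) ≤ 3 * π ^ 2)
        linarith

/-- **Order-1 column structure, even sector.**  For `a > 0`, `1 ≤ m`, `2i ≤ m`:
`|M⁺_{gramCoeff a}(i,m) − (−1)^{i+m} g_m/(4m)| ≤ κ⁺(i)/m²` with `g_m = 1 + (4/π)Σ_k (Λ_k/√k) sin(ω_m log k)` and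
`κ⁺(i) = s²a/π² + 2i·ΛΣ/π + i/2 + 8a(1+E)/(3π²)`. -/
theorem abs_evenKernel_col_sub_le (ha : 0 < a) {i m : ℕ} (hm : 1 ≤ m) (him : 2 * i ≤ m) :
    |(if i = 0 then gramCoeff a 0 m else if m = 0 then gramCoeff a i 0
        else (gramCoeff a i m + gramCoeff a i (-(m : ℤ))) / 2)
      - (-1 : ℝ) ^ ((i : ℤ) + m) *
        (1 + 4 / π * ∑ k ∈ weilPrimeIndex a, (Λ k : ℝ) / Real.sqrt k * Real.sin (freq a m * Real.log k)) / (4 * m)|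
      ≤ ((Real.exp (a / 2) - Real.exp (-(a / 2))) ^ 2 * a / π ^ 2
          + 2 * i * (∑ k ∈ weilPrimeIndex a, (Λ k : ℝ) / Real.sqrt k) / π
          + ((i : ℝ) / 2 + 8 * a * (1 + weilArchDensity (2 * a)) / (3 * π ^ 2))) / (m : ℝ) ^ 2 := by
  have him' : i < m := by omega
  have hm0 : (0 : ℝ) < m := by exact_mod_cast hm
  -- split the kernel into the three pieces
  have hsplit : (if i = 0 then gramCoeff a 0 m else if m = 0 then gramCoeff a i 0
        else (gramCoeff a i m + gramCoeff a i (-(m : ℤ))) / 2)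
      = (if i = 0 then polarCoeff a 0 m else if m = 0 then polarCoeff a i 0
          else (polarCoeff a i m + polarCoeff a i (-(m : ℤ))) / 2)
        + (if i = 0 then primeCoeff a 0 m else if m = 0 then primeCoeff a i 0
          else (primeCoeff a i m + primeCoeff a i (-(m : ℤ))) / 2)
        + (if i = 0 then archCoeff a 0 m else if m = 0 then archCoeff a i 0
          else (archCoeff a i m + archCoeff a i (-(m : ℤ))) / 2) := by
    by_cases hi : i = 0
    · subst hi; simp only [if_true]; unfold gramCoeff; ring
    · have hm' : m ≠ 0 := by omega
      simp only [if_neg hi, if_neg hm']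
      unfold gramCoeff; ring
  have hP := abs_evenPolar_col_le ha hm (ne_of_lt him')
  have hQ := abs_evenPrime_col_sub_le a hm him
  have hR := abs_evenArch_col_sub_le ha hm him
  -- the main parts add up: (−1)^{i+m}[Σ w sin/(πm) + 1/(4m)] = (−1)^{i+m}(1 + (4/π)Σ w sin)/(4m)
  have e : (if i = 0 then gramCoeff a 0 m else if m = 0 then gramCoeff a i 0
        else (gramCoeff a i m + gramCoeff a i (-(m : ℤ))) / 2)
      - (-1 : ℝ) ^ ((i : ℤ) + m) *
        (1 + 4 / π * ∑ k ∈ weilPrimeIndex a, (Λ k : ℝ) / Real.sqrt k * Real.sin (freq a m * Real.log k)) / (4 * m)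
      = (if i = 0 then polarCoeff a 0 m else if m = 0 then polarCoeff a i 0
          else (polarCoeff a i m + polarCoeff a i (-(m : ℤ))) / 2)
        + ((if i = 0 then primeCoeff a 0 m else if m = 0 then primeCoeff a i 0
            else (primeCoeff a i m + primeCoeff a i (-(m : ℤ))) / 2)
          - (-1 : ℝ) ^ ((i : ℤ) + m) *
            (∑ k ∈ weilPrimeIndex a, (Λ k : ℝ) / Real.sqrt k * Real.sin (freq a m * Real.log k)) / (π * m))
        + ((if i = 0 then archCoeff a 0 m else if m = 0 then archCoeff a i 0
            else (archCoeff a i m + archCoeff a i (-(m : ℤ))) / 2)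
          - (-1 : ℝ) ^ ((i : ℤ) + m) / (4 * m)) := by
    rw [hsplit]
    field_simp
    ring
  rw [e]
  refine ((abs_add_le _ _).trans (add_le_add ((abs_add_le _ _).trans (add_le_add hP hQ)) hR)).trans (le_of_eq ?_)
  ring

end Remainder

end Summit.RiemannHypothesis.RiemannHypothesis.Theorems.WeilFormatC

end
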